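import Mathlib
import HarnessLib

/-!
# Route `UnthreadedDoor`, crux `PoloidalLiouville` (stmt-NavierStokesRegularity-1222), WALL W1 — «height-head» tooling:
# REAL-ANALYTIC DEPENDENCE OF INTERVAL INTEGRALS ON PARAMETERS (generic analysis helper)

Tool for `HeightHead.AnalyticNormalisation` of ns-idea-14's crux idea «height-head»
(`Cruxes/PoloidalLiouville/HeightHeadSketch.lean`, the lemma whose docstring names the Mathlib gap
`analyticOnNhd_intervalIntegral`).  THE statement Mathlib lacks (searched `nalytic.*ntegral`,
`hasFPowerSeries.*ntegral`: only the one-variable primitive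
`Literature.NumberTheory.ConnesConsani2021.hasFPowerSeriesOnBall_intervalIntegral`):

* `analyticOnNhd_intervalIntegral_param`: if `(s, x) ↦ F s x` is (jointly) real-analytic at every
  point of `[[a, b]] × U`, `U` open in a real normed space `E`, values in a real Banach space `G`, then
  `x ↦ ∫ s in a..b, F s x` is real-analytic on `U`.

The proof is DIRECT and REAL (no complexification, no Cauchy estimates):

* LOCAL STEP `hasFPowerSeriesOnBall_intervalIntegral_param`: if `F` has a power series `p` at `(s₀, x₀)`
  with radius `R > δ + r` and `|s − s₀| ≤ δ` on `[[a, b]]`, move the origin along the parameter axis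
  (`HasFPowerSeriesOnBall.changeOrigin`): `F s (x₀ + h) = Σₖ (p.changeOrigin (s − s₀, 0))ₖ ((0,h), …, (0,h))`;
  the coefficients are continuous in `s` (`hasFPowerSeriesOnBall_changeOrigin`) and dominated UNIFORMLY in
  `s ∈ [[a,b]]` by `Bₖ = Σ' ‖p (k+l)‖ δ^l · #{…}` with `Σ Bₖ rᵏ < ∞` (`changeOriginSeries_summable_aux₁`,
  the majorant behind Mathlib's `changeOrigin_radius`); so the Bochner integrals `∫ (p.changeOrigin (s − s₀, 0))ₖ ds`
  (in the Banach space of `k`-linear maps), precomposed with `inr` in every slot, form a power series of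
  radius `≥ r` summing to the integral (dominated convergence `intervalIntegral.hasSum_integral_of_dominated_convergence`).
* GLOBAL STEP: Lebesgue-number subdivision of `[[a, b]]` into finitely many pieces, each inside one local ball,
  and `intervalIntegral.sum_integral_adjacent_intervals`.

Standard real-analytic function theory (cf. Krantz–Parks, *A Primer of Real Analytic Functions* (2002), Ch. 2);
generic (no NS objects) — a Literature port `Literature/Analysis/Calculus/ParametricIntegralAnalytic.lean` waits only
on the exact locator (acq-14342).  WHAT THIS IS NOT: no NS statement; every height-head Prop, `PoloidalLiouville`
(1222), W1 and NS regularity stay OPEN.  `--supports stmt-NavierStokesRegularity-1222 --as helper`.  [folklore]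
-/

noncomputable section

-- the summit and its single sub-problem share the name (CONVENTIONS §1)
set_option linter.dupNamespace false


open _root_.MeasureTheory Set Filter Metric intervalIntegral FormalMultilinearSeries
open scoped Topology NNReal ENNReal

namespace Summit.NavierStokesRegularity.NavierStokesRegularity.Theorems.PoloidalLiouville.NetFlux

variable {E G : Type*} [NormedAddCommGroup E] [NormedSpace ℝ E] [NormedAddCommGroup G] [NormedSpace ℝ G]
  [CompleteSpace G]

/-- **Local step: termwise integration of a power series in the parameter direction.**  If
`(s, x) ↦ F s x` has the power series `p` at `(s₀, x₀)` on the ball of radius `R`, `δ + r < R` (`r > 0`), and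
`|s − s₀| ≤ δ` for all `s ∈ [[a, b]]`, then `x ↦ ∫ s in a..b, F s x` has at `x₀`, on the ball of radius `r`,
the power series whose `k`-th coefficient is the Bochner integral `∫ s in a..b, (p.changeOrigin (s − s₀, 0))ₖ`
restricted to the `E`-directions (precomposition with `ContinuousLinearMap.inr ℝ ℝ E` in every slot). [folklore] -/
theorem hasFPowerSeriesOnBall_intervalIntegral_param {F : ℝ → E → G}
    {p : FormalMultilinearSeries ℝ (ℝ × E) G} {s₀ : ℝ} {x₀ : E} {R : ℝ≥0∞} {δ r : ℝ≥0}
    (hp : HasFPowerSeriesOnBall (fun z : ℝ × E => F z.1 z.2) p (s₀, x₀) R)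
    (hR : ((δ + r : ℝ≥0) : ℝ≥0∞) < R) (hr : 0 < r) {a b : ℝ}
    (hab : ∀ s ∈ uIcc a b, ‖s - s₀‖₊ ≤ δ) :
    HasFPowerSeriesOnBall (fun x => ∫ s in a..b, F s x)
      (fun k => (∫ s in a..b, p.changeOrigin ((s - s₀, (0 : E)) : ℝ × E) k).compContinuousLinearMap
        fun _ => ContinuousLinearMap.inr ℝ ℝ E) x₀ r := by
  -- the path of origins along the parameter axis
  set y : ℝ → ℝ × E := fun s => ((s - s₀, (0 : E)) : ℝ × E) with hy
  have hy_norm : ∀ s, ‖y s‖₊ = ‖s - s₀‖₊ := by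
    intro s
    simp [hy, Prod.nnnorm_def]
  have hRle : R ≤ p.radius := hp.r_le
  have hδR : (δ : ℝ≥0∞) < R := lt_of_le_of_lt (by exact_mod_cast le_self_add) hR
  have hy_lt : ∀ s ∈ uIcc a b, (‖y s‖₊ : ℝ≥0∞) < R := fun s hs => by
    rw [hy_norm]
    exact lt_of_le_of_lt (ENNReal.coe_le_coe.2 (hab s hs)) hδR
  have hpos : 0 < p.radius := lt_of_le_of_lt (bot_le : (0 : ℝ≥0∞) ≤ δ) (hδR.trans_le hRle)
  -- the uniform majorant of the moved coefficients
  set B : ℕ → ℝ≥0 := fun k =>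
    ∑' σ : Σ l : ℕ, {t : Finset (Fin (k + l)) // t.card = l}, ‖p (k + σ.1)‖₊ * δ ^ σ.1 with hB
  have hBsum : Summable fun k => B k * r ^ k := by
    have h1 := p.changeOriginSeries_summable_aux₁ (r := δ) (r' := r) (hR.trans_le hRle)
    show Summable fun k =>
      (∑' σ : Σ l : ℕ, {t : Finset (Fin (k + l)) // t.card = l}, ‖p (k + σ.1)‖₊ * δ ^ σ.1) * r ^ k
    simpa only [← NNReal.tsum_mul_right] using (NNReal.summable_sigma.1 h1).2
  have hbound : ∀ s ∈ uIcc a b, ∀ k, ‖p.changeOrigin (y s) k‖₊ ≤ B k := by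
    intro s hs k
    have h1 : (‖y s‖₊ : ℝ≥0∞) < p.radius := (hy_lt s hs).trans_le hRle
    refine (p.nnnorm_changeOrigin_le k h1).trans ?_
    refine Summable.tsum_le_tsum (fun σ => ?_) (p.changeOriginSeries_summable_aux₂ h1 k)
      (p.changeOriginSeries_summable_aux₂ (hδR.trans_le hRle) k)
    have h2 : ‖y s‖₊ ≤ δ := by rw [hy_norm]; exact hab s hs
    gcongr
  -- continuity of the moved coefficients in the parameter
  have hcont : ∀ k, ContinuousOn (fun s => p.changeOrigin (y s) k) (uIcc a b) := by
    intro k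
    have h1 := (p.hasFPowerSeriesOnBall_changeOrigin k hpos).continuousOn
    refine h1.comp (by fun_prop : Continuous y).continuousOn (fun s hs => ?_)
    rw [Metric.mem_eball, edist_zero_right, enorm_eq_nnnorm]
    exact (hy_lt s hs).trans_le hRle
  have hintk : ∀ k, IntervalIntegrable (fun s => p.changeOrigin (y s) k) volume a b := fun k =>
    (hcont k).intervalIntegrable
  -- norm of the restriction to the `E`-directions
  have hinr : ∀ k, (∏ _i : Fin k, ‖ContinuousLinearMap.inr ℝ ℝ E‖) ≤ 1 := by
    intro k
    refine Finset.prod_le_one (fun _ _ => norm_nonneg _) (fun _ _ => ?_)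
    refine ContinuousLinearMap.opNorm_le_bound _ zero_le_one (fun x => ?_)
    simp [Prod.norm_def]
  refine ⟨?_, ENNReal.coe_pos.2 hr, ?_⟩
  · -- radius ≥ r
    refine le_radius_of_summable _ ?_
    have h1 : Summable fun k => |b - a| * ((B k : ℝ) * (r : ℝ) ^ k) := by
      have := NNReal.summable_coe.2 hBsum
      push_cast at this
      exact this.mul_left _
    refine Summable.of_nonneg_of_le (fun k => by positivity) (fun k => ?_) h1
    have h2 : ‖(∫ s in a..b, p.changeOrigin (y s) k).compContinuousLinearMap
        fun _ => ContinuousLinearMap.inr ℝ ℝ E‖ ≤ |b - a| * B k := by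
      refine (ContinuousMultilinearMap.norm_compContinuousLinearMap_le _ _).trans ?_
      have h3 : ‖∫ s in a..b, p.changeOrigin (y s) k‖ ≤ (B k : ℝ) * |b - a| :=
        intervalIntegral.norm_integral_le_of_norm_le_const fun s hs => by
          exact_mod_cast hbound s (uIoc_subset_uIcc hs) k
      calc ‖∫ s in a..b, p.changeOrigin (y s) k‖ * ∏ _i : Fin k, ‖ContinuousLinearMap.inr ℝ ℝ E‖
          ≤ ((B k : ℝ) * |b - a|) * 1 :=
            mul_le_mul h3 (hinr k) (Finset.prod_nonneg fun _ _ => norm_nonneg _) (by positivity)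
        _ = |b - a| * B k := by ring
    calc ‖(∫ s in a..b, p.changeOrigin (y s) k).compContinuousLinearMap
          fun _ => ContinuousLinearMap.inr ℝ ℝ E‖ * (r : ℝ) ^ k
        ≤ (|b - a| * B k) * (r : ℝ) ^ k := by gcongr
      _ = |b - a| * ((B k : ℝ) * (r : ℝ) ^ k) := by ring
  · -- the sum
    intro h hh
    have hh' : ‖h‖₊ < r := by
      rwa [Metric.mem_eball, edist_zero_right, enorm_eq_nnnorm, ENNReal.coe_lt_coe] at hh
    -- pointwise in the parameter
    have hpt : ∀ s ∈ uIcc a b,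
        HasSum (fun k => p.changeOrigin (y s) k fun _ => ((0 : ℝ), h)) (F s (x₀ + h)) := by
      intro s hs
      have h1 := hp.changeOrigin (hy_lt s hs)
      have h2 : (((0 : ℝ), h) : ℝ × E) ∈ eball (0 : ℝ × E) (R - ‖y s‖₊) := by
        rw [Metric.mem_eball, edist_zero_right, enorm_eq_nnnorm]
        have h0 : ‖(((0 : ℝ), h) : ℝ × E)‖₊ = ‖h‖₊ := by simp [Prod.nnnorm_def]
        rw [h0]
        calc (‖h‖₊ : ℝ≥0∞) < r := ENNReal.coe_lt_coe.2 hh'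
          _ ≤ R - δ := by
              apply ENNReal.le_sub_of_add_le_left ENNReal.coe_ne_top
              exact_mod_cast hR.le
          _ ≤ R - ‖y s‖₊ := tsub_le_tsub_left (by rw [hy_norm]; exact_mod_cast hab s hs) _
      have h3 := h1.hasSum h2
      convert h3 using 2 <;> simp [hy]
    -- measurability
    have hmeas : ∀ k, AEStronglyMeasurable (fun s => p.changeOrigin (y s) k fun _ => ((0 : ℝ), h))
        (volume.restrict (uIoc a b)) := by
      intro k
      refine ContinuousOn.aestronglyMeasurable ?_ measurableSet_uIoc
      exact ((continuous_eval_const (fun _ : Fin k => (((0 : ℝ), h) : ℝ × E))).comp_continuousOn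
        (hcont k)).mono uIoc_subset_uIcc
    -- dominated convergence
    have key := intervalIntegral.hasSum_integral_of_dominated_convergence
      (F := fun k s => p.changeOrigin (y s) k fun _ => ((0 : ℝ), h)) (f := fun s => F s (x₀ + h))
      (fun k _ => (B k : ℝ) * ‖h‖ ^ k) hmeas
      (fun k => Eventually.of_forall fun s hs => by
        calc ‖p.changeOrigin (y s) k fun _ => ((0 : ℝ), h)‖
            ≤ ‖p.changeOrigin (y s) k‖ * ∏ _i : Fin k, ‖(((0 : ℝ), h) : ℝ × E)‖ :=
              ContinuousMultilinearMap.le_opNorm _ _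
          _ = ‖p.changeOrigin (y s) k‖ * ‖h‖ ^ k := by simp [Prod.norm_def]
          _ ≤ B k * ‖h‖ ^ k := by
              have h5 : (‖p.changeOrigin (y s) k‖ : ℝ) ≤ B k := by
                exact_mod_cast hbound s (uIoc_subset_uIcc hs) k
              gcongr)
      (Eventually.of_forall fun s _ => by
        have h5 : ‖h‖₊ ≤ r := hh'.le
        have : Summable fun k => B k * ‖h‖₊ ^ k :=
          NNReal.summable_of_le (fun k => by gcongr) hBsum
        have := NNReal.summable_coe.2 this
        push_cast at this
        exact this)
      intervalIntegrable_const
      (Eventually.of_forall fun s hs => hpt s (uIoc_subset_uIcc hs))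
    convert key using 1
    funext k
    rw [ContinuousMultilinearMap.compContinuousLinearMap_apply]
    have hc := (ContinuousMultilinearMap.apply ℝ (fun _ : Fin k => ℝ × E) G
      (fun _ => (((0 : ℝ), h) : ℝ × E))).intervalIntegral_comp_comm (hintk k)
    simpa [ContinuousMultilinearMap.apply_apply] using hc.symm

/-- **Real-analyticity of a parametric interval integral at a point.**  If `(s, x) ↦ F s x` is real-analytic
at every point of `[[a, b]] × U` (`U` open, `x₀ ∈ U`), then `x ↦ ∫ s in a..b, F s x` is real-analytic at `x₀`.
Proof: Lebesgue-number subdivision of `[[a, b]]` + the local step + additivity of the interval integral. [folklore] -/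
theorem analyticAt_intervalIntegral_param {F : ℝ → E → G} {a b : ℝ} {U : Set E} (hU : IsOpen U)
    {x₀ : E} (hx₀ : x₀ ∈ U)
    (hF : ∀ s ∈ uIcc a b, ∀ x ∈ U, AnalyticAt ℝ (fun z : ℝ × E => F z.1 z.2) (s, x)) :
    AnalyticAt ℝ (fun x => ∫ s in a..b, F s x) x₀ := by
  -- integrability of the slices on sub-intervals, for every `x ∈ U`
  have hint : ∀ x ∈ U, ∀ c d, c ∈ uIcc a b → d ∈ uIcc a b →
      IntervalIntegrable (fun s => F s x) volume c d := by
    intro x hx c d hc hd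
    refine ContinuousOn.intervalIntegrable fun s hs => ?_
    have h1 : ContinuousAt (fun z : ℝ × E => F z.1 z.2) (s, x) :=
      (hF s (uIcc_subset_uIcc hc hd hs) x hx).continuousAt
    have h2 : ContinuousAt (fun s : ℝ => ((s, x) : ℝ × E)) s := by fun_prop
    exact (ContinuousAt.comp (f := fun s : ℝ => ((s, x) : ℝ × E)) h1 h2).continuousWithinAt
  -- local analyticity near every parameter value
  have hloc : ∀ s ∈ uIcc a b, ∃ ε > (0 : ℝ), ∀ c d, uIcc c d ⊆ ball s ε →
      AnalyticAt ℝ (fun x => ∫ t in c..d, F t x) x₀ := by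
    intro s hs
    obtain ⟨p, R, hp⟩ := hF s hs x₀ hx₀
    obtain ⟨ρ, hρ0, hρR⟩ := ENNReal.lt_iff_exists_nnreal_btwn.1 hp.r_pos
    have hρ0' : 0 < ρ := by exact_mod_cast hρ0
    refine ⟨(ρ : ℝ) / 2, by positivity, fun c d hcd => ?_⟩
    have h2 : ((ρ / 2 + ρ / 2 : ℝ≥0) : ℝ≥0∞) < R := by rwa [add_halves]
    refine (hasFPowerSeriesOnBall_intervalIntegral_param hp h2 (half_pos hρ0') (a := c) (b := d)
      fun t ht => ?_).analyticAt
    have h3 : dist t s < ρ / 2 := hcd ht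
    rw [dist_eq_norm] at h3
    have h4 : (‖t - s‖₊ : ℝ) ≤ ((ρ / 2 : ℝ≥0) : ℝ) := by push_cast; exact h3.le
    exact_mod_cast h4
  choose! ε hε hA using hloc
  -- Lebesgue number of the cover of `[[a, b]]` by the local balls
  obtain ⟨δ, hδ, hL⟩ := lebesgue_number_lemma_of_metric (ι := {s // s ∈ uIcc a b})
    (c := fun i => ball i.1 (ε i.1)) isCompact_uIcc (fun _ => isOpen_ball)
    (fun s hs => mem_iUnion.2 ⟨⟨s, hs⟩, mem_ball_self (hε s hs)⟩)
  -- subdivision of `[[a, b]]` into `N` pieces of length `< δ`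
  obtain ⟨N, hN⟩ := exists_nat_gt (|b - a| / δ)
  have hN0 : 0 < (N : ℝ) := lt_of_le_of_lt (by positivity) hN
  have hNne : (N : ℝ) ≠ 0 := hN0.ne'
  set t : ℕ → ℝ := fun j => a + j * ((b - a) / N) with ht
  have ht0 : t 0 = a := by simp [ht]
  have htN : t N = b := by
    simp only [ht]
    field_simp
    ring
  have htmem : ∀ j ≤ N, t j ∈ uIcc a b := by
    intro j hj
    have hθ0 : (0 : ℝ) ≤ j / N := by positivity
    have hθ1 : (j : ℝ) / N ≤ 1 := by
      rw [div_le_one hN0]; exact_mod_cast hj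
    have hrepr : t j = a + (j / N) * (b - a) := by simp only [ht]; ring
    rw [hrepr, mem_uIcc]
    rcases le_total a b with hab | hab
    · left; constructor <;> nlinarith
    · right; constructor <;> nlinarith
  have hstep : ∀ j, t (j + 1) - t j = (b - a) / N := by
    intro j; simp only [ht]; push_cast; ring
  have hlen : |b - a| / N < δ := by
    rw [div_lt_iff₀ hN0]
    calc |b - a| = |b - a| / δ * δ := by field_simp
      _ < N * δ := by gcongr
      _ = δ * N := mul_comm _ _
  have hpiece : ∀ j < N, AnalyticAt ℝ (fun x => ∫ s in t j..t (j + 1), F s x) x₀ := by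
    intro j hj
    obtain ⟨i, hi⟩ := hL (t j) (htmem j hj.le)
    refine hA i.1 i.2 _ _ (Subset.trans (fun s hs => ?_) hi)
    rw [mem_ball]
    calc dist s (t j) = |s - t j| := Real.dist_eq _ _
      _ ≤ |t (j + 1) - t j| := abs_sub_left_of_mem_uIcc hs
      _ = |b - a| / N := by rw [hstep, abs_div, Nat.abs_cast]
      _ < δ := hlen
  have hsum : AnalyticAt ℝ (fun x => ∑ j ∈ Finset.range N, ∫ s in t j..t (j + 1), F s x) x₀ := by
    have := Finset.analyticAt_sum (Finset.range N) fun j hj => hpiece j (Finset.mem_range.1 hj)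
    convert this using 1
    funext x
    simp [Finset.sum_apply]
  refine hsum.congr (eventuallyEq_of_mem (hU.mem_nhds hx₀) fun x hx => ?_)
  have := intervalIntegral.sum_integral_adjacent_intervals (μ := volume) (f := fun s => F s x) (a := t)
    (n := N) fun j hj => hint x hx _ _ (htmem j hj.le) (htmem (j + 1) hj)
  rw [this, ht0, htN]

/-- **Real-analyticity of parametric interval integrals.**  If `(s, x) ↦ F s x` is (jointly) real-analytic at
every point of `[[a, b]] × U`, with `U` open in a real normed space `E` and values in a real Banach space `G`,
then the parametric integral `x ↦ ∫ s in a..b, F s x` is real-analytic on `U`.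
(Cf. Krantz–Parks 2002, Ch. 2: real-analytic functions are stable under integration in a parameter.) [folklore] -/
theorem analyticOnNhd_intervalIntegral_param {F : ℝ → E → G} {a b : ℝ} {U : Set E} (hU : IsOpen U)
    (hF : ∀ s ∈ uIcc a b, ∀ x ∈ U, AnalyticAt ℝ (fun z : ℝ × E => F z.1 z.2) (s, x)) :
    AnalyticOnNhd ℝ (fun x => ∫ s in a..b, F s x) U :=
  fun _ hx => analyticAt_intervalIntegral_param hU hx hF

/-- **Real-analyticity of parametric interval integrals**, uncurried form: if `uncurry F` is real-analytic on a
neighbourhood of every point of `[[a, b]] ×ˢ U` (`U` open), then `x ↦ ∫ s in a..b, F s x` is real-analytic on `U`.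
[folklore] -/
theorem analyticOnNhd_intervalIntegral_param' {F : ℝ → E → G} {a b : ℝ} {U : Set E} (hU : IsOpen U)
    (hF : AnalyticOnNhd ℝ (Function.uncurry F) (uIcc a b ×ˢ U)) :
    AnalyticOnNhd ℝ (fun x => ∫ s in a..b, F s x) U :=
  analyticOnNhd_intervalIntegral_param hU fun s hs x hx => hF (s, x) (mk_mem_prod hs hx)

end Summit.NavierStokesRegularity.NavierStokesRegularity.Theorems.PoloidalLiouville.NetFlux
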